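import Literature.Analysis.FluidPDE.TaoLocalisation
import HarnessLib

/-!
# Tao (2011/2013), *Localisation and compactness properties of the Navier–Stokes global
# regularity problem* — the enstrophy localisation theorem and the proof of Cor. 11.1
# (family `ns`, topic `Literature/Analysis/FluidPDE`)

Second layer of the decomposition of the named fact `NS.tao2011_hasBoundedSobolevNormsOn`
(`TaoLocalisation.lean`): its first ingredient `NS.tao2011_boundedEnstrophy` (Tao2011,
Cor. 11.1, *bounded enstrophy*) is **proved** here (`NS.tao2011_boundedEnstrophy_of_parts`) from
the two results its printed proof invokes, vendored as named facts (D-0014: `def … : Prop`, no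
`sorry`):

* `NS.tao2011_enstrophyLocalisation_exterior` — Tao2011, **Thm. 10.1** (*Enstrophy
  localisation*; arXiv v4 p. 54, conditions (77)–(79)) in the exterior-region form of
  **Remark 10.6** (arXiv v4 pp. 63–64: ball `B(x₀, R)` replaced by `ℝ³ ∖ B(x₀, R)` and
  `B(x₀, R - r)` by `ℝ³ ∖ B(x₀, R + r)`), homogeneous case `f = 0`, viscosity `ν > 0`.
* `NS.tao2011_sobolev_of_vorticity` — the closing step of the printed proof of Cor. 11.1 (arXiv
  v4 p. 68): "Since `u` is divergence-free and `ω = ∇ × u`, the claim then follows from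
  Fourier analysis", i.e. the `L²` control of `∇u` by `ω` and of `∇²u` by `∇ω` for divergence-free
  fields (`|ξ|²|û|² = |ξ × û|²` when `ξ · û = 0`; in physical space the identity
  `∫|curl u|² = ∫|∇u|²` for divergence-free `u`, Doering–Gibbon 1995, §6.1, (6.1.5)–(6.1.6),
  printed p. 115 — stated there on periodic domains; the whole-space version is the one proved
  here). **Discharged** in the sibling file `TaoEnstrophyLocalisationProofs.lean`
  (`NS.tao2011_sobolev_of_vorticity_holds`).

Everything else in the printed proof of Cor. 11.1 is carried out in Lean:

* the choice of `δ` (condition (78): `δ⁴T + δ⁵E^{1/2}T ≤ c`), of `r`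
  (condition (79)) and, by continuity from above of `B ↦ ∫_B |ω₀|²`
  ("by the monotone convergence theorem, we thus have for `R` sufficiently large that
  `‖ω₀‖_{L²(ℝ³ ∖ B(0,R))} ≤ δ`"), of `R` (`NS.exists_setLIntegral_compl_ball_le`);
* the interior bound "as `u` is almost smooth, `ω` also lies in `L^∞_t L²_x ∩ L²_t H¹_x` in the
  interior region" — from the joint smoothness of `u` on the compact `[0, T] × B̄(0, R + r)`
  (`Fluid.IsSmoothSpaceTimeOn.exists_bound_iteratedFDeriv`, via
  `Fluid.IsSmoothSpaceTimeOn.iteratedFDeriv_slice`: all spatial derivatives of a jointly smooth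
  field are jointly smooth) and the pointwise control of `curl v`, `D(curl v)` by `Dv`, `D²v`
  (`Fluid.curlCLM`: the curl is a fixed linear map of the Jacobian);
* the gluing of interior and exterior bounds (`lintegral_add_compl`).

Tao's appeal to Lemma 8.1 (`u ∈ L^∞_t L²_x ∩ L²_t H¹_x`) is not needed for the three quantities
recorded by `NS.MemSobolevX 1 T u` (`sup_t ‖u‖²_{L²}` is the finite-energy hypothesis itself,
`sup_t ‖Du‖²_{L²}` and `∫₀ᵀ ‖D²u‖²_{L²}` come from `ω` through `tao2011_sobolev_of_vorticity`).

Remaining named facts below `NS.tao2011_hasBoundedSobolevNormsOn` after this file: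
`tao2011_enstrophyLocalisation_exterior` (Thm. 10.1: Thm. 8.2 local energy, Prop. 9.1 bounded
total speed, §10), `tao2011_sobolev_of_vorticity` (Plancherel),
`tao2011_hasBoundedSobolevNormsOn_of_memSobolevX` (Cor. 4.3 + Thm. 5.4 (iv)).

## References

* T. Tao, *Localisation and compactness properties of the Navier–Stokes global regularity
  problem*, Anal. PDE 6 (2013), 25–107; arXiv:1108.1165 (`Tao2011`), pages of arXiv v4: §1
  (pp. 3–4, (6), footnote 3), Thm. 10.1 and Remark 10.2 (p. 54, conditions (77)–(79)),
  Remark 10.6 (pp. 63–64), Cor. 11.1 (p. 68). (The held 51-page text rendering of the same arXiv paper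
  numbers all statements sequentially: there Thm. 10.1 = "Theorem 59", p. 30; Remark 10.6 =
  "Remark 64", p. 33; Cor. 11.1 = "Corollary 68", p. 36.)
* C. R. Doering, J. D. Gibbon, *Applied Analysis of the Navier–Stokes Equations*, CUP (1995)
  (`DoeringGibbon1995`), Ch. 6, §6.1, eqs. (6.1.5)–(6.1.9), printed pp. 115–116 (the book's table
  of contents puts §6.1 at p. 114 and §6.2 at p. 117; in the held 209-page scan these are scan
  pp. 95–97). (6.1.5)–(6.1.6) are stated there "on periodic domains for divergence-free fields";
  the whole-space version is what `TaoEnstrophyLocalisationProofs.lean` proves.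
-/

noncomputable section

open MeasureTheory Set Function Filter Topology WithLp
open scoped ENNReal NNReal InnerProductSpace RealInnerProductSpace ContDiff

/-! ## The curl as a linear image of the Jacobian; pointwise bounds -/

namespace Literature.Analysis.FluidPDE

/-- Local notation for physical space `ℝ³ = EuclideanSpace ℝ (Fin 3)`. -/
local notation "ℝ³" => EuclideanSpace ℝ (Fin 3)

/-- The linear map `D ↦ (D₂₃ − D₃₂, D₃₁ − D₁₃, D₁₂ − D₂₁)` (`Dⱼᵢ = (D eⱼ)ᵢ`) sending a Jacobian
matrix to the corresponding curl vector, so that `curl v x = curlLM (Dv(x))` by the very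
definition of the accepted `Fluid.curl` (Majda–Bertozzi, eq. (1.20)). [folklore] -/
def curlLM : (ℝ³ →L[ℝ] ℝ³) →ₗ[ℝ] ℝ³ where
  toFun D := toLp 2 ![D (EuclideanSpace.single 1 1) 2 - D (EuclideanSpace.single 2 1) 1,
    D (EuclideanSpace.single 2 1) 0 - D (EuclideanSpace.single 0 1) 2,
    D (EuclideanSpace.single 0 1) 1 - D (EuclideanSpace.single 1 1) 0]
  map_add' D D' := by
    rw [← WithLp.toLp_add]
    congr 1
    funext i
    fin_cases i <;> simp <;> ring
  map_smul' c D := by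
    rw [← WithLp.toLp_smul]
    congr 1
    funext i
    fin_cases i <;> simp <;> ring

/-- `curlLM` as a continuous linear map (finite dimension). [folklore] -/
def curlCLM : (ℝ³ →L[ℝ] ℝ³) →L[ℝ] ℝ³ :=
  LinearMap.toContinuousLinearMap curlLM

/-- `curl v x` is `curlCLM` applied to the Jacobian `Dv(x)` (definitional). [folklore] -/
theorem curl_eq_curlCLM (v : ℝ³ → ℝ³) (x : ℝ³) : curl v x = curlCLM (fderiv ℝ v x) := rfl

/-- `curl v = curlCLM ∘ Dv` (definitional). [folklore] -/
theorem curl_eq_curlCLM_comp (v : ℝ³ → ℝ³) : curl v = curlCLM ∘ fderiv ℝ v := rfl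

/-- Pointwise control of the vorticity by the velocity gradient: `|curl v(x)| ≤ κ ‖Dv(x)‖` with
`κ = ‖curlCLM‖`. [folklore] -/
theorem norm_curl_le (v : ℝ³ → ℝ³) (x : ℝ³) : ‖curl v x‖ ≤ ‖curlCLM‖ * ‖fderiv ℝ v x‖ := by
  rw [curl_eq_curlCLM]
  exact curlCLM.le_opNorm _

/-- Chain rule: `D(curl v)(x) = curlCLM ∘ D(Dv)(x)` for `v ∈ C²`. [folklore] -/
theorem fderiv_curl {v : ℝ³ → ℝ³} (hv : ContDiff ℝ 2 v) (x : ℝ³) :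
    fderiv ℝ (curl v) x = curlCLM.comp (fderiv ℝ (fderiv ℝ v) x) := by
  rw [curl_eq_curlCLM_comp]
  have hd : DifferentiableAt ℝ (fderiv ℝ v) x :=
    ((hv.fderiv_right (m := 1) (by norm_num)).differentiable one_ne_zero).differentiableAt
  exact (curlCLM.hasFDerivAt.comp x hd.hasFDerivAt).fderiv

/-- Pointwise control of the vorticity gradient by the velocity Hessian:
`‖D(curl v)(x)‖ ≤ κ ‖D²v(x)‖` for `v ∈ C²`, `κ = ‖curlCLM‖`. [folklore] -/
theorem norm_fderiv_curl_le {v : ℝ³ → ℝ³} (hv : ContDiff ℝ 2 v) (x : ℝ³) :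
    ‖fderiv ℝ (curl v) x‖ ≤ ‖curlCLM‖ * ‖iteratedFDeriv ℝ 2 v x‖ := by
  rw [fderiv_curl hv]
  refine (ContinuousLinearMap.opNorm_comp_le _ _).trans ?_
  rw [← norm_iteratedFDeriv_one (𝕜 := ℝ) (fderiv ℝ v), norm_iteratedFDeriv_fderiv]

/-! ## Spatial derivatives of jointly smooth fields are jointly smooth; compact bounds -/

section SpaceTime

variable {X : Type*} [NormedAddCommGroup X] [NormedSpace ℝ X]
variable {F : Type*} [NormedAddCommGroup F] [NormedSpace ℝ F]

/-- The slice derivative of a jointly smooth field is the joint derivative (within `S × X`)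
composed with the inclusion `x ↦ (0, x)` (chain rule along `y ↦ (t, y)`). [folklore] -/
theorem IsSmoothSpaceTimeOn.fderiv_slice_eq {S : Set ℝ} {w : ℝ → X → F}
    (h : IsSmoothSpaceTimeOn S w) {t : ℝ} (ht : t ∈ S) (x : X) :
    fderiv ℝ (w t) x =
      (fderivWithin ℝ (uncurry w) (S ×ˢ univ) (t, x)).comp (ContinuousLinearMap.inr ℝ ℝ X) := by
  have h1 : HasFDerivWithinAt (uncurry w) (fderivWithin ℝ (uncurry w) (S ×ˢ univ) (t, x))
      (S ×ˢ univ) (t, x) :=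
    ((h (t, x) (mk_mem_prod ht (mem_univ x))).differentiableWithinAt (by simp)).hasFDerivWithinAt
  have h2 : HasFDerivAt (fun y : X => ((t, y) : ℝ × X)) (ContinuousLinearMap.inr ℝ ℝ X) x :=
    hasFDerivAt_prodMk_right t x
  have h3 := h1.comp_hasFDerivAt x h2 (Eventually.of_forall fun y => mk_mem_prod ht (mem_univ y))
  exact h3.fderiv

/-- The slice derivatives `(t, x) ↦ D(w t)(x)` of a jointly smooth field on `S × X` (`S` of unique
differentiability, e.g. `Icc 0 T` with `T > 0`) form a jointly smooth field. [folklore] -/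
theorem IsSmoothSpaceTimeOn.fderiv_slice {S : Set ℝ} {w : ℝ → X → F}
    (h : IsSmoothSpaceTimeOn S w) (hS : UniqueDiffOn ℝ S) :
    IsSmoothSpaceTimeOn S (fun t x => fderiv ℝ (w t) x) := by
  have hU : UniqueDiffOn ℝ (S ×ˢ (univ : Set X)) := hS.prod uniqueDiffOn_univ
  have hD : ContDiffOn ℝ ∞ (fderivWithin ℝ (uncurry w) (S ×ˢ univ)) (S ×ˢ univ) :=
    h.fderivWithin hU (by simp)
  have hc : ContDiffOn ℝ ∞
      (fun q : ℝ × X => (fderivWithin ℝ (uncurry w) (S ×ˢ univ) q).comp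
        (ContinuousLinearMap.inr ℝ ℝ X)) (S ×ˢ univ) :=
    hD.clm_comp contDiffOn_const
  refine hc.congr ?_
  rintro ⟨t, x⟩ ⟨ht, -⟩
  exact h.fderiv_slice_eq ht x

/-- All spatial derivatives `(t, x) ↦ Dⁿ(w t)(x)` of a jointly smooth field on `S × X` (`S` of
unique differentiability) are jointly smooth fields (induction on `n`, `Dⁿ⁺¹ = curry ∘ D ∘ Dⁿ`). [folklore] -/
theorem IsSmoothSpaceTimeOn.iteratedFDeriv_slice {S : Set ℝ} {w : ℝ → X → F}
    (h : IsSmoothSpaceTimeOn S w) (hS : UniqueDiffOn ℝ S) :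
    ∀ n : ℕ, IsSmoothSpaceTimeOn S (fun t x => iteratedFDeriv ℝ n (w t) x) := by
  intro n
  induction n with
  | zero =>
    have : (uncurry fun t x => iteratedFDeriv ℝ 0 (w t) x) =
        (continuousMultilinearCurryFin0 ℝ X F).symm ∘ uncurry w := by
      funext ⟨t, x⟩; rfl
    change ContDiffOn ℝ ∞ _ _
    rw [this]
    exact (continuousMultilinearCurryFin0 ℝ X F).symm.contDiff.comp_contDiffOn h
  | succ n ih =>
    have h' := ih.fderiv_slice hS
    have : (uncurry fun t x => iteratedFDeriv ℝ (n + 1) (w t) x) =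
        (continuousMultilinearCurryLeftEquiv ℝ (fun _ : Fin (n + 1) => X) F).symm ∘
          uncurry fun t x => fderiv ℝ (fun y => iteratedFDeriv ℝ n (w t) y) x := by
      funext ⟨t, x⟩; rfl
    change ContDiffOn ℝ ∞ _ _
    rw [this]
    exact (continuousMultilinearCurryLeftEquiv ℝ (fun _ : Fin (n + 1) => X) F).symm.contDiff
      |>.comp_contDiffOn h'

/-- A jointly smooth (hence jointly continuous) field is bounded on `S × K` for `S` and `K`
compact. [folklore] -/
theorem IsSmoothSpaceTimeOn.exists_bound {S : Set ℝ} {w : ℝ → X → F}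
    (h : IsSmoothSpaceTimeOn S w) (hS : IsCompact S) {K : Set X} (hK : IsCompact K) :
    ∃ M : ℝ, ∀ t ∈ S, ∀ x ∈ K, ‖w t x‖ ≤ M := by
  have hc : ContinuousOn (uncurry w) (S ×ˢ K) :=
    h.continuousOn.mono (prod_mono Subset.rfl (subset_univ _))
  obtain ⟨M, hM⟩ := (hS.prod hK).exists_bound_of_continuousOn hc
  exact ⟨M, fun t ht x hx => hM (t, x) (mk_mem_prod ht hx)⟩

/-- Uniform bounds for all spatial derivatives of a jointly smooth field on `S × K`, `S` and `K`
compact ("as `u` is almost smooth, `ω` also lies in `L^∞_t L²_x ∩ L²_t H¹_x` in the interior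
region", Tao2011, proof of Cor. 11.1). [folklore] -/
theorem IsSmoothSpaceTimeOn.exists_bound_iteratedFDeriv {S : Set ℝ} {w : ℝ → X → F}
    (h : IsSmoothSpaceTimeOn S w) (hS : IsCompact S) (hS' : UniqueDiffOn ℝ S) {K : Set X}
    (hK : IsCompact K) (n : ℕ) :
    ∃ M : ℝ, ∀ t ∈ S, ∀ x ∈ K, ‖iteratedFDeriv ℝ n (w t) x‖ ≤ M :=
  (h.iteratedFDeriv_slice hS' n).exists_bound hS hK

end SpaceTime

end Literature.Analysis.FluidPDE

namespace Literature.Analysis.FluidPDE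

/-- Local notation for physical space `ℝ³ = EuclideanSpace ℝ (Fin 3)`. -/
local notation "ℝ³" => EuclideanSpace ℝ (Fin 3)

/-! ## Two measure-theoretic steps of the proof of Cor. 11.1 -/

/-- "By the monotone convergence theorem, we thus have for `R` sufficiently large that
`‖ω₀‖_{L²(ℝ³ ∖ B(0,R))} ≤ δ`" (Tao2011, proof of Cor. 11.1): if `∫ f < ∞` then for every `ε > 0`
and every `ρ` there is `R > ρ` with `∫_{ℝ³ ∖ B(0,R)} f ≤ ε` (continuity from above of the measure
`f · dx` along the exteriors of the balls `B(0, n)`, whose intersection is empty). [folklore] -/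
theorem exists_setLIntegral_compl_ball_le {f : ℝ³ → ℝ≥0∞} (hf : ∫⁻ x, f x < ⊤) {ε : ℝ≥0∞}
    (hε : 0 < ε) (ρ : ℝ) :
    ∃ R : ℝ, ρ < R ∧ ∫⁻ x in (Metric.ball (0 : ℝ³) R)ᶜ, f x ≤ ε := by
  set μ' : Measure ℝ³ := volume.withDensity f with hμ'
  set s : ℕ → Set ℝ³ := fun n => (Metric.ball (0 : ℝ³) n)ᶜ with hs
  have hsm : ∀ n, NullMeasurableSet (s n) μ' := fun n =>
    (measurableSet_ball.compl).nullMeasurableSet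
  have hanti : Antitone s := by
    intro n m hnm
    exact compl_subset_compl.2 (Metric.ball_subset_ball (by exact_mod_cast hnm))
  have hfin : ∃ n, μ' (s n) ≠ ⊤ := by
    refine ⟨0, ne_top_of_le_ne_top hf.ne ?_⟩
    rw [hμ', withDensity_apply _ (measurableSet_ball.compl)]
    exact setLIntegral_le_lintegral _ _
  have hlim := tendsto_measure_iInter_atTop hsm hanti hfin
  have hempty : (⋂ n, s n) = ∅ := by
    simp only [hs, ← compl_iUnion, Metric.iUnion_ball_nat, compl_univ]
  rw [hempty, measure_empty] at hlim
  have hev : ∀ᶠ n : ℕ in atTop, μ' (s n) < ε := (tendsto_order.1 hlim).2 ε hε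
  obtain ⟨n, hn, hn'⟩ := (hev.and (eventually_gt_atTop ⌈ρ⌉₊)).exists
  refine ⟨n, ?_, ?_⟩
  · exact (Nat.le_ceil ρ).trans_lt (by exact_mod_cast hn')
  · have := hn.le
    rwa [hμ', withDensity_apply _ (measurableSet_ball.compl)] at this

/-- A pointwise bound `‖g‖ ≤ M` on the closed ball `B̄(0, ρ)` bounds `∫_{B(0,ρ)} ‖g‖²` by
`M² · vol B(0, ρ)`. [folklore] -/
theorem setLIntegral_ball_enorm_sq_le {F : Type*} [NormedAddCommGroup F] {g : ℝ³ → F} {ρ M : ℝ}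
    (hg : ∀ x ∈ Metric.closedBall (0 : ℝ³) ρ, ‖g x‖ ≤ M) :
    ∫⁻ x in Metric.ball (0 : ℝ³) ρ, ‖g x‖ₑ ^ 2 ≤
      ENNReal.ofReal (M ^ 2) * volume (Metric.ball (0 : ℝ³) ρ) := by
  calc ∫⁻ x in Metric.ball (0 : ℝ³) ρ, ‖g x‖ₑ ^ 2
      ≤ ∫⁻ _ in Metric.ball (0 : ℝ³) ρ, ENNReal.ofReal (M ^ 2) := by
        refine setLIntegral_mono' measurableSet_ball fun x hx => ?_
        have h1 : ‖g x‖ ≤ M := hg x (Metric.ball_subset_closedBall hx)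
        rw [← ofReal_norm, ← ENNReal.ofReal_pow (norm_nonneg _)]
        exact ENNReal.ofReal_le_ofReal (pow_le_pow_left₀ (norm_nonneg _) h1 2)
    _ = ENNReal.ofReal (M ^ 2) * volume (Metric.ball (0 : ℝ³) ρ) := setLIntegral_const _ _

/-! ## The two named facts -/

/-- **Tao 2011, Thm. 10.1 (Enstrophy localisation), exterior-region form of Remark 10.6**
(arXiv v4: Thm. 10.1 p. 54 with conditions (77)–(79), Remark 10.6 pp. 63–64), homogeneous case
`f = 0`. Printed statement
(`ν = 1`): "Let `(u, p, u₀, f, T)` be a finite energy almost smooth solution. Let `B(x₀, R)` be a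
ball such that `‖ω₀‖_{L²(B(x₀,R))} + ‖∇ × f‖_{L¹_t L²_x([0,T] × B(x₀,R))} ≤ δ` (77) for some
`δ > 0`, where `ω₀ := ∇ × u₀` is the initial vorticity. Assume the smallness condition
`δ⁴T + δ⁵E(u₀,f,T)^{1/2}T ≤ c` (78) for some sufficiently small absolute constant `c > 0`. Let
`0 < r < R/2` be a quantity such that `r > C(E(u₀,f,T) + E(u₀,f,T)^{1/2}T^{1/4} + δ⁻²)` (79)
for some sufficiently large absolute constant `C`. Then
`‖ω‖_{L^∞_t L²_x([0,T] × B(x₀,R−r))} + ‖∇ω‖_{L²_t L²_x([0,T] × B(x₀,R−r))} ≲ δ`." Remark 10.6: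
the same holds with `B(x₀, R)` replaced by the exterior region `ℝ³ ∖ B(x₀, R)` and `B(x₀, R − r)`
by `ℝ³ ∖ B(x₀, R + r)` — the form in which the theorem is "inverted" in the proof of Cor. 11.1,
and the form vendored here. Dictionary (as in `TaoLocalisation.lean`): the solution is a
classical solution on the **closed** slab `[0, T] × ℝ³` (`Fluid.IsClassicalNSSolutionOn (Icc 0 T)`,
a subclass of Tao's almost smooth solutions) of finite energy ((6): `sup_t ∫|u(t)|² < ∞`,
hypothesis `_hfe`); `E(u₀, 0, T) = ½‖u₀‖²_{L²}` and the fact is stated for any `E ≥ E(u₀, 0, T)`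
(`_hE₀`; conditions (78), (79) are monotone in `E`, so this is the printed statement);
`ω = curl u` is the accepted `Fluid.curl`, `|ω|` its Euclidean norm, and `|∇ω|` is replaced by
the operator norm of the Fréchet derivative `D(curl u(t))` (at most the Euclidean tensor norm, so
the conclusion is implied by the printed one); `L^∞_t` on `[0, T]` is written as a bound for every
`t ∈ [0, T]` (equal to the essential supremum for the jointly smooth `u`, by Fatou), and the two
summands of the conclusion are bounded separately by `Aδ`. **Viscosity.** Tao normalises `ν = 1`
(footnote 3: reduce by rescaling); for `ν > 0` the substitution `v(s, x) = ν⁻¹u(s/ν, x)`,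
`q(s, x) = ν⁻²p(s/ν, x)` gives a `ν = 1` solution on `[0, νT]` with `E ↦ ν⁻²E`, `δ ↦ ν⁻¹δ`,
`ω ↦ ν⁻¹ω`, lengths unchanged, so the printed theorem yields the present one with constants
depending on `ν` only (e.g. `c(ν) = ½c·min(ν³, ν⁵)`, `C(ν) = C·max(ν⁻², ν^{-3/4}, ν²)`,
`A(ν) = A·max(1, ν^{-1/2})`) — whence the quantifier pattern `∀ ν > 0, ∃ c C A`. [cite: Tao2011, Thm. 10.1 + Remark 10.6] -/
def tao2011_enstrophyLocalisation_exterior : Prop :=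
  ∀ ⦃ν : ℝ⦄ (_hν : 0 < ν), ∃ c C A : ℝ, 0 < c ∧ 0 < C ∧ 0 < A ∧
    ∀ ⦃T : ℝ⦄ (_hT : 0 < T) ⦃u : ℝ → ℝ³ → ℝ³⦄ ⦃p : ℝ → ℝ³ → ℝ⦄
      (_hsol : FluidPDE.IsClassicalNSSolutionOn (Icc 0 T) ν 0 u p)
      (_hfe : ∃ C' : ℝ≥0, ∀ t ∈ Icc 0 T, ∫⁻ x, ‖u t x‖ₑ ^ 2 ≤ C')
      ⦃E : ℝ⦄ (_hE : 0 ≤ E) (_hE₀ : ∫⁻ x, ‖u 0 x‖ₑ ^ 2 ≤ ENNReal.ofReal (2 * E))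
      (x₀ : ℝ³) ⦃R r δ : ℝ⦄ (_hδ : 0 < δ) (_hr : 0 < r) (_hrR : r < R / 2)
      (_hω₀ : ∫⁻ x in (Metric.ball x₀ R)ᶜ, ‖FluidPDE.curl (u 0) x‖ₑ ^ 2 ≤ ENNReal.ofReal (δ ^ 2))
      (_hsmall : δ ^ 4 * T + δ ^ 5 * Real.sqrt E * T ≤ c)
      (_hlarge : C * (E + Real.sqrt E * T ^ (1 / 4 : ℝ) + δ⁻¹ ^ 2) < r),
      (∀ t ∈ Icc 0 T, ∫⁻ x in (Metric.ball x₀ (R + r))ᶜ, ‖FluidPDE.curl (u t) x‖ₑ ^ 2 ≤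
          ENNReal.ofReal ((A * δ) ^ 2)) ∧
        ∫⁻ t in Ioo 0 T, ∫⁻ x in (Metric.ball x₀ (R + r))ᶜ,
            ‖fderiv ℝ (FluidPDE.curl (u t)) x‖ₑ ^ 2 ≤ ENNReal.ofReal ((A * δ) ^ 2)

/-- **Velocity derivatives from the vorticity of a divergence-free field** — the closing step of
the printed proof of Tao2011, Cor. 11.1 (arXiv v4 p. 68): "meanwhile … `u ∈ L^∞_t L²_x`…
Since `u` is divergence-free and `ω = ∇ × u`, the claim [`u ∈ X¹ = L^∞_t H¹_x ∩ L²_t H²_x`, given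
`ω ∈ L^∞_t L²_x ∩ L²_t H¹_x`] then follows from Fourier analysis." Slice-wise content: for a smooth
divergence-free `v : ℝ³ → ℝ³` in `L²` (so that `v̂ ∈ L²` and `ξ · v̂(ξ) = 0` a.e., whence
`|ξ|²|v̂|² = |ξ × v̂|²`), if `curl v ∈ L²` then `∇v ∈ L²` with `‖∇v‖_{L²} ≲ ‖curl v‖_{L²}`, and if
`∇(curl v) ∈ L²` then `∇²v ∈ L²` with `‖∇²v‖_{L²} ≲ ‖∇ curl v‖_{L²}` (Plancherel; in physical
space the identity `∫|curl u|² = ∫|∇u|²` for divergence-free `u`, Doering–Gibbon 1995, §6.1,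
(6.1.5)–(6.1.6), printed p. 115, stated on periodic domains; whole-space version proved here).
**Proved** (`K = 3`) as `NS.tao2011_sobolev_of_vorticity_holds` in
`TaoEnstrophyLocalisationProofs.lean`.
Stated with lower Lebesgue integrals (the inequalities are trivial when the right side is
infinite), operator norms of the Fréchet derivatives `Dv = iteratedFDeriv ℝ 1 v`,
`D²v = iteratedFDeriv ℝ 2 v`, `D(curl v)`, and an unspecified constant `K` absorbing the
comparison between operator and Euclidean tensor norms. [cite: Tao2011, Cor. 11.1 (proof, last step)] -/
def tao2011_sobolev_of_vorticity : Prop :=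
  ∃ K : ℝ≥0, ∀ ⦃v : ℝ³ → ℝ³⦄ (_hv : ContDiff ℝ ∞ v) (_hdiv : VectorCalculus.IsDivFree v)
    (_hL2 : ∫⁻ x, ‖v x‖ₑ ^ 2 < ⊤),
    (∫⁻ x, ‖iteratedFDeriv ℝ 1 v x‖ₑ ^ 2 ≤ K * ∫⁻ x, ‖FluidPDE.curl v x‖ₑ ^ 2) ∧
      (∫⁻ x, ‖iteratedFDeriv ℝ 2 v x‖ₑ ^ 2 ≤ K * ∫⁻ x, ‖fderiv ℝ (FluidPDE.curl v) x‖ₑ ^ 2)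

/-! ## Proof of Cor. 11.1 from Thm. 10.1 (exterior form) and the Fourier step -/

/-- Pointwise-bound-to-integral step used twice below: from `‖curl (u t) x‖ ≤ κ‖D(u t) x‖`
one gets `∫ |curl u(0)|² ≤ κ² ∫ ‖Du(0)‖²`. [folklore] -/
theorem lintegral_curl_sq_le (v : ℝ³ → ℝ³) :
    ∫⁻ x, ‖FluidPDE.curl v x‖ₑ ^ 2 ≤
      ENNReal.ofReal (‖FluidPDE.curlCLM‖ ^ 2) * ∫⁻ x, ‖iteratedFDeriv ℝ 1 v x‖ₑ ^ 2 := by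
  rw [← lintegral_const_mul' _ _ ENNReal.ofReal_ne_top]
  refine lintegral_mono fun x => ?_
  have h := FluidPDE.norm_curl_le v x
  rw [← norm_iteratedFDeriv_one] at h
  have h0 : 0 ≤ ‖FluidPDE.curlCLM‖ * ‖iteratedFDeriv ℝ 1 v x‖ := by positivity
  calc ‖FluidPDE.curl v x‖ₑ ^ 2 = ENNReal.ofReal (‖FluidPDE.curl v x‖ ^ 2) := by
        rw [← ofReal_norm, ENNReal.ofReal_pow (norm_nonneg _)]
    _ ≤ ENNReal.ofReal ((‖FluidPDE.curlCLM‖ * ‖iteratedFDeriv ℝ 1 v x‖) ^ 2) :=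
        ENNReal.ofReal_le_ofReal (pow_le_pow_left₀ (norm_nonneg _) h 2)
    _ = ENNReal.ofReal (‖FluidPDE.curlCLM‖ ^ 2) * ‖iteratedFDeriv ℝ 1 v x‖ₑ ^ 2 := by
        rw [mul_pow, ENNReal.ofReal_mul (sq_nonneg _), ← ofReal_norm (iteratedFDeriv ℝ 1 v x),
          ENNReal.ofReal_pow (norm_nonneg _)]

/-- **Tao 2011, Cor. 11.1 (Bounded enstrophy), proved from Thm. 10.1 (exterior form,
`tao2011_enstrophyLocalisation_exterior`) and the Fourier step
(`tao2011_sobolev_of_vorticity`)**, following the printed proof (arXiv v4 p. 68): the datum has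
`ω₀ = curl u(0) ∈ L²` (from `∫‖Du(0)‖² < ∞`), so for `δ` small enough that (78) holds
(`δ = min(1, c/(T(1 + √E)))`, `E = ½‖u(0)‖²_{L²}`) and `r` as in (79) there is, by continuity
from above, `R > 2r` with `∫_{ℝ³∖B(0,R)} |ω₀|² ≤ δ²`; Thm. 10.1 (inverted) bounds
`sup_t ∫_{ℝ³∖B(0,R+r)} |ω|²` and `∫₀ᵀ∫_{ℝ³∖B(0,R+r)} |∇ω|²`; on `[0,T] × B̄(0,R+r)` the jointly
smooth `u` has `Du`, `D²u` — hence `ω`, `∇ω` — bounded; gluing, `sup_t ∫|ω|² < ∞` and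
`∫₀ᵀ∫|∇ω|² < ∞`, and the Fourier step turns these into `sup_t ∫‖Du‖² < ∞`, `∫₀ᵀ∫‖D²u‖² < ∞`,
which together with the finite-energy hypothesis is `u ∈ X¹([0,T] × ℝ³)`. [cite: Tao2011, Cor. 11.1] -/
theorem tao2011_boundedEnstrophy_of_parts (hA : tao2011_enstrophyLocalisation_exterior)
    (hB : tao2011_sobolev_of_vorticity) : tao2011_boundedEnstrophy := by
  intro ν T hν hT u p hsol hE h₀
  obtain ⟨C₀, hC₀⟩ := hE
  obtain ⟨K, hK⟩ := hB
  obtain ⟨c, C, A, hc, hC, hApos, hmain⟩ := hA hν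
  have hsm : FluidPDE.IsSmoothSpaceTimeOn (Icc 0 T) u := hsol.smooth_velocity
  have hUD : UniqueDiffOn ℝ (Icc 0 T) := uniqueDiffOn_Icc hT
  have hu : ∀ t ∈ Icc 0 T, ContDiff ℝ ∞ (u t) := fun t ht => hsol.contDiff_velocity ht
  have hL2 : ∀ t ∈ Icc 0 T, ∫⁻ x, ‖u t x‖ₑ ^ 2 < ⊤ := fun t ht =>
    (hC₀ t ht).trans_lt ENNReal.coe_lt_top
  have h0mem : (0 : ℝ) ∈ Icc 0 T := ⟨le_rfl, hT.le⟩
  -- the energy `E = ½ ‖u(0)‖²`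
  set E : ℝ := (∫⁻ x, ‖u 0 x‖ₑ ^ 2).toReal / 2 with hEdef
  have hE0 : 0 ≤ E := by positivity
  have hE₀ : ∫⁻ x, ‖u 0 x‖ₑ ^ 2 ≤ ENNReal.ofReal (2 * E) := by
    rw [hEdef, mul_div_cancel₀ _ (two_ne_zero), ENNReal.ofReal_toReal (hL2 0 h0mem).ne]
  -- the choice of `δ` (condition (78))
  set δ : ℝ := min 1 (c / (T * (1 + Real.sqrt E))) with hδdef
  have hden : 0 < T * (1 + Real.sqrt E) := by positivity
  have hδpos : 0 < δ := lt_min one_pos (div_pos hc hden)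
  have hδ1 : δ ≤ 1 := min_le_left _ _
  have hsmall : δ ^ 4 * T + δ ^ 5 * Real.sqrt E * T ≤ c := by
    have h4 : δ ^ 4 ≤ δ := pow_le_of_le_one hδpos.le hδ1 (by norm_num)
    have h5 : δ ^ 5 ≤ δ := pow_le_of_le_one hδpos.le hδ1 (by norm_num)
    have hsq : 0 ≤ Real.sqrt E := Real.sqrt_nonneg _
    calc δ ^ 4 * T + δ ^ 5 * Real.sqrt E * T ≤ δ * T + δ * Real.sqrt E * T := by
          gcongr
      _ = δ * (T * (1 + Real.sqrt E)) := by ring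
      _ ≤ c / (T * (1 + Real.sqrt E)) * (T * (1 + Real.sqrt E)) := by
          gcongr; exact min_le_right _ _
      _ = c := div_mul_cancel₀ _ hden.ne'
  -- the choice of `r` (condition (79))
  set r : ℝ := C * (E + Real.sqrt E * T ^ (1 / 4 : ℝ) + δ⁻¹ ^ 2) + 1 with hrdef
  have hlarge : C * (E + Real.sqrt E * T ^ (1 / 4 : ℝ) + δ⁻¹ ^ 2) < r := lt_add_one _
  have hrpos : 0 < r := by
    have : 0 ≤ C * (E + Real.sqrt E * T ^ (1 / 4 : ℝ) + δ⁻¹ ^ 2) := by positivity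
    linarith
  -- the choice of `R`: small exterior initial enstrophy (monotone convergence)
  have hcurl0 : ∫⁻ x, ‖FluidPDE.curl (u 0) x‖ₑ ^ 2 < ⊤ :=
    (lintegral_curl_sq_le (u 0)).trans_lt (ENNReal.mul_lt_top ENNReal.ofReal_lt_top h₀)
  have hδ2 : (0 : ℝ≥0∞) < ENNReal.ofReal (δ ^ 2) := ENNReal.ofReal_pos.2 (by positivity)
  obtain ⟨R, hR2r, hω₀⟩ := exists_setLIntegral_compl_ball_le hcurl0 hδ2 (2 * r)
  have hrR : r < R / 2 := by linarith
  -- Theorem 10.1, inverted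
  obtain ⟨hext1, hext2⟩ :=
    hmain hT hsol ⟨C₀, hC₀⟩ hE0 hE₀ 0 hδpos hrpos hrR hω₀ hsmall hlarge
  -- interior bounds from joint smoothness on `[0,T] × B̄(0, R + r)`
  set ρ : ℝ := R + r with hρ
  obtain ⟨M₁, hM₁⟩ := hsm.exists_bound_iteratedFDeriv isCompact_Icc hUD
    (isCompact_closedBall (0 : ℝ³) ρ) 1
  obtain ⟨M₂, hM₂⟩ := hsm.exists_bound_iteratedFDeriv isCompact_Icc hUD
    (isCompact_closedBall (0 : ℝ³) ρ) 2
  set κ : ℝ := ‖FluidPDE.curlCLM‖ with hκ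
  have hκ0 : 0 ≤ κ := by rw [hκ]; exact norm_nonneg FluidPDE.curlCLM
  have hcurl_pt : ∀ t ∈ Icc 0 T, ∀ x ∈ Metric.closedBall (0 : ℝ³) ρ,
      ‖FluidPDE.curl (u t) x‖ ≤ κ * M₁ := by
    intro t ht x hx
    refine (FluidPDE.norm_curl_le (u t) x).trans ?_
    rw [← norm_iteratedFDeriv_one]
    exact mul_le_mul_of_nonneg_left (hM₁ t ht x hx) hκ0
  have hdcurl_pt : ∀ t ∈ Icc 0 T, ∀ x ∈ Metric.closedBall (0 : ℝ³) ρ,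
      ‖fderiv ℝ (FluidPDE.curl (u t)) x‖ ≤ κ * M₂ := by
    intro t ht x hx
    refine (FluidPDE.norm_fderiv_curl_le ((hu t ht).of_le (by norm_cast)) x).trans ?_
    exact mul_le_mul_of_nonneg_left (hM₂ t ht x hx) hκ0
  have hvol : volume (Metric.ball (0 : ℝ³) ρ) < ⊤ := measure_ball_lt_top
  -- gluing: total enstrophy, uniformly in `t`
  set W₁ : ℝ≥0∞ := ENNReal.ofReal ((κ * M₁) ^ 2) * volume (Metric.ball (0 : ℝ³) ρ) +
    ENNReal.ofReal ((A * δ) ^ 2) with hW₁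
  have hW₁top : W₁ < ⊤ :=
    ENNReal.add_lt_top.2 ⟨ENNReal.mul_lt_top ENNReal.ofReal_lt_top hvol, ENNReal.ofReal_lt_top⟩
  have hω : ∀ t ∈ Icc 0 T, ∫⁻ x, ‖FluidPDE.curl (u t) x‖ₑ ^ 2 ≤ W₁ := by
    intro t ht
    rw [← lintegral_add_compl _ (measurableSet_ball (x := (0 : ℝ³)) (ε := ρ))]
    exact add_le_add (setLIntegral_ball_enorm_sq_le (hcurl_pt t ht)) (hext1 t ht)
  -- gluing: `∫₀ᵀ ∫ |∇ω|²`
  set W₂ : ℝ≥0∞ := ENNReal.ofReal ((κ * M₂) ^ 2) * volume (Metric.ball (0 : ℝ³) ρ) with hW₂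
  have hW₂top : W₂ < ⊤ := ENNReal.mul_lt_top ENNReal.ofReal_lt_top hvol
  have hdω : ∫⁻ t in Ioo 0 T, ∫⁻ x, ‖fderiv ℝ (FluidPDE.curl (u t)) x‖ₑ ^ 2 ≤
      W₂ * volume (Ioo (0 : ℝ) T) + ENNReal.ofReal ((A * δ) ^ 2) := by
    calc ∫⁻ t in Ioo 0 T, ∫⁻ x, ‖fderiv ℝ (FluidPDE.curl (u t)) x‖ₑ ^ 2
        = ∫⁻ t in Ioo 0 T, ((∫⁻ x in Metric.ball (0 : ℝ³) ρ, ‖fderiv ℝ (FluidPDE.curl (u t)) x‖ₑ ^ 2) +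
            ∫⁻ x in (Metric.ball (0 : ℝ³) ρ)ᶜ, ‖fderiv ℝ (FluidPDE.curl (u t)) x‖ₑ ^ 2) := by
          congr 1; funext t
          rw [lintegral_add_compl _ (measurableSet_ball (x := (0 : ℝ³)) (ε := ρ))]
      _ ≤ ∫⁻ t in Ioo 0 T, (W₂ +
            ∫⁻ x in (Metric.ball (0 : ℝ³) ρ)ᶜ, ‖fderiv ℝ (FluidPDE.curl (u t)) x‖ₑ ^ 2) := by
          refine setLIntegral_mono' measurableSet_Ioo fun t ht => ?_
          exact add_le_add (setLIntegral_ball_enorm_sq_le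
            (hdcurl_pt t (Ioo_subset_Icc_self ht))) le_rfl
      _ = (∫⁻ _ in Ioo 0 T, W₂) +
            ∫⁻ t in Ioo 0 T, ∫⁻ x in (Metric.ball (0 : ℝ³) ρ)ᶜ,
              ‖fderiv ℝ (FluidPDE.curl (u t)) x‖ₑ ^ 2 :=
          lintegral_add_left measurable_const _
      _ ≤ W₂ * volume (Ioo (0 : ℝ) T) + ENNReal.ofReal ((A * δ) ^ 2) := by
          rw [setLIntegral_const]
          exact add_le_add le_rfl hext2
  -- conclusion: `u ∈ X¹([0,T] × ℝ³)`
  refine ⟨fun j hj => ?_, ?_⟩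
  · rcases Nat.le_one_iff_eq_zero_or_eq_one.1 hj with rfl | rfl
    · refine ⟨C₀, fun t ht => ?_⟩
      have : ∀ x, ‖iteratedFDeriv ℝ 0 (u t) x‖ₑ = ‖u t x‖ₑ := fun x => by
        rw [← ofReal_norm, ← ofReal_norm, norm_iteratedFDeriv_zero]
      simp only [this]
      exact hC₀ t ht
    · refine ⟨((K : ℝ≥0∞) * W₁).toNNReal, fun t ht => ?_⟩
      rw [ENNReal.coe_toNNReal (ENNReal.mul_lt_top ENNReal.coe_lt_top hW₁top).ne]
      exact ((hK (hu t ht) (hsol.divFree t ht) (hL2 t ht)).1).trans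
        (mul_le_mul_right (hω t ht) _)
  · calc ∫⁻ t in Ioo 0 T, ∫⁻ x, ‖iteratedFDeriv ℝ (1 + 1) (u t) x‖ₑ ^ 2
        ≤ ∫⁻ t in Ioo 0 T, (K : ℝ≥0∞) * ∫⁻ x, ‖fderiv ℝ (FluidPDE.curl (u t)) x‖ₑ ^ 2 :=
          setLIntegral_mono' measurableSet_Ioo fun t ht =>
            (hK (hu t (Ioo_subset_Icc_self ht)) (hsol.divFree t (Ioo_subset_Icc_self ht))
              (hL2 t (Ioo_subset_Icc_self ht))).2
      _ = (K : ℝ≥0∞) * ∫⁻ t in Ioo 0 T, ∫⁻ x, ‖fderiv ℝ (FluidPDE.curl (u t)) x‖ₑ ^ 2 :=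
          lintegral_const_mul' _ _ ENNReal.coe_ne_top
      _ < ⊤ := by
          refine ENNReal.mul_lt_top ENNReal.coe_lt_top (hdω.trans_lt ?_)
          exact ENNReal.add_lt_top.2
            ⟨ENNReal.mul_lt_top hW₂top (by simp), ENNReal.ofReal_lt_top⟩

/-- **The state of `NS.tao2011_hasBoundedSobolevNormsOn` after this file** (proved): it follows
from Thm. 10.1 (exterior form), the Fourier step, and Cor. 4.3 + Thm. 5.4 (iv)
(`tao2011_hasBoundedSobolevNormsOn_of_memSobolevX`), by `tao2011_boundedEnstrophy_of_parts` and
`tao2011_hasBoundedSobolevNormsOn_of_parts`. [cite: Tao2011, Cor. 11.1 + Cor. 4.3 + Thm. 5.4 (iv)] -/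
theorem tao2011_hasBoundedSobolevNormsOn_of_parts' (hA : tao2011_enstrophyLocalisation_exterior)
    (hB : tao2011_sobolev_of_vorticity) (hC : tao2011_hasBoundedSobolevNormsOn_of_memSobolevX) :
    tao2011_hasBoundedSobolevNormsOn :=
  tao2011_hasBoundedSobolevNormsOn_of_parts (tao2011_boundedEnstrophy_of_parts hA hB) hC

end Literature.Analysis.FluidPDE

end
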